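import Summits.AnomalousDissipation.AnomalousDissipation.Theorems.QuarticGate.Negative.LevelOneQuad
import Summits.AnomalousDissipation.AnomalousDissipation.Theorems.QuarticGate.Negative.DefectCertificateCasimir
import Literature.Analysis.FunctionSpaces.TorusAxisAverage

/-!
# Negative knowledge for the crux `MomentParity.QuarticGate` (stmt-AnomalousDissipation-11464),
# line `axis-sectors`: the shear-symmetric stubs at level one

(cdisprove seat g3, 2026-08-16.) The picked line `Cruxes/QuarticGate/Lines/axis-sectors.lean` runs the
recession-cone surgery equivariantly under the shear group `G′ = {a : 𝕋³ | a 1 = 0}` and replaces the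
all-sector Casimir stub by two AXIAL ones, `stub_axialQuadRigidity` (S2q, `∀ N ≥ 2, ∀ L > 2N`) and
`stub_noAxialCubicCasimir` (S2c, `∃ᶠ N, ∀ L > 3N`), whose Casimirs are additionally invariant under the
finite shear subgroup `H_L = {a | a 1 = 0, L • a = 0}`; its lever at order 3 is
`stub_axialDefectCertificate` (S3′: "no `H_L`-invariant cubic Casimir ⟹ defect certificate for every
`H_L`-symmetric law").

This file records, sorry-free, that the extra SYMMETRY hypotheses do not rescue any of the level-one
degeneracies of `LevelOne.lean` / `LevelOneQuad.lean` / `DefectCertificateCasimir.lean`, because the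
laminar Kolmogorov family `K_a = a cos(2πx₁)e₀` is itself shear invariant (`kolField_add_of_apply_one`):

* `not_axialQuadRigidityAt_one`: the body of S2q is FALSE at `N = 1` for EVERY symmetry order `L`
  (witness: the `G′`-invariant quadratic Casimir `(u, K_1)²`) — the guard `2 ≤ N` of S2q is load-bearing
  even in the shear-invariant class (`not_forall_axialQuadRigidityAt_of_one_le`);
* `not_noAxialCubicCasimirAt_one`: the body of S2c is FALSE at `N = 1` for every `L` (witness: the
  `G′`-invariant cubic Casimir `(u, K_1)³`) — the `∃ᶠ N` of S2c cannot be strengthened to "all `N ≥ 1`"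
  (`not_forall_noAxialCubicCasimirAt_of_one_le`);
* `not_axialDefectCertificateUnconditional`: S3′ with its no-Casimir antecedent deleted is FALSE
  (witness: `N = 1`, `L = 4`, `ν = 1`, `f = 0`, `μ = δ_{[K_1]}` — a shear-symmetric law in the sense of
  the line, `lawSym_dirac_kolState`, for which `not_hasDefectCertificate_dirac_kolState` applies).

Infrastructure of independent use to the lead: `mFourier_apply_add` (characters are multiplicative in
the point), `realTrigPoly_add_of_mFourier_eq_one` (a real trigonometric polynomial is invariant under
every translation on which all its characters are trivial), `pairing_kolState_comp_add`
(`([K_b], g(· + a)) = ([K_b], g)` for `a 1 = 0`), `lawSym_dirac_kolState` (the Dirac mass at a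
shear-invariant state has `H_L`-invariant cylindrical statistics, for every `L`).
-/

namespace Summit.AnomalousDissipation.AnomalousDissipation.Theorems.QuarticGate.Negative

open MeasureTheory Filter Topology
open scoped ENNReal InnerProductSpace RealInnerProductSpace
open Literature.Analysis.FunctionSpaces Literature.Analysis.FluidPDE
open Summit.AnomalousDissipation.AnomalousDissipation.Theses.MomentParity

-- `Summit.<Summit>.<Problem>` is the tree's mandated summit-side namespace (CONVENTIONS §2); for this
-- single-conjunct summit the two coincide, so the duplicate is deliberate.
set_option linter.dupNamespace false

noncomputable section

/-- Local notation for the real Hilbert space `L²(T³; ℝ³)`. -/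
local notation "L2T3" => Lp (EuclideanSpace ℝ (Fin 3)) 2 (volume : Measure (UnitAddTorus (Fin 3)))

/-! ## Shear invariance of the laminar Kolmogorov family -/

/-- Characters of `𝕋³` are multiplicative in the point: `e_k(x + a) = e_k(x) e_k(a)`. [folklore] -/
theorem mFourier_apply_add (k : Fin 3 → ℤ) (x a : UnitAddTorus (Fin 3)) :
    UnitAddTorus.mFourier k (x + a) = UnitAddTorus.mFourier k x * UnitAddTorus.mFourier k a := by
  simp only [UnitAddTorus.mFourier, ContinuousMap.coe_mk, Pi.add_apply, Torus.fourier_apply_add,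
    Finset.prod_mul_distrib]

/-- A real trigonometric polynomial is invariant under every translation `a` on which all of its
characters are trivial (`e_k(a) = 1` for `k ∈ S`). [folklore] -/
theorem realTrigPoly_add_of_mFourier_eq_one {S : Finset (Fin 3 → ℤ)}
    (c : (Fin 3 → ℤ) → EuclideanSpace ℂ (Fin 3)) {a : UnitAddTorus (Fin 3)}
    (ha : ∀ k ∈ S, UnitAddTorus.mFourier k a = 1) (x : UnitAddTorus (Fin 3)) :
    Torus.realTrigPoly S c (x + a) = Torus.realTrigPoly S c x := by
  simp only [Torus.realTrigPoly_apply_eq_sum]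
  refine Finset.sum_congr rfl fun k hk => ?_
  rw [mFourier_apply_add, ha k hk, mul_one]

/-- The characters `e_{±e₁}` of the Kolmogorov frequencies are trivial on the shear group
`G′ = {a | a 1 = 0}`. [folklore] -/
theorem mFourier_eq_one_of_mem_kolSet {k : Fin 3 → ℤ} (hk : k ∈ kolSet) {a : UnitAddTorus (Fin 3)}
    (ha : a 1 = 0) : UnitAddTorus.mFourier k a = 1 := by
  simp only [kolSet, Finset.mem_insert, Finset.mem_singleton] at hk
  simp only [UnitAddTorus.mFourier, ContinuousMap.coe_mk, Fin.prod_univ_three]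
  rcases hk with rfl | rfl <;> simp [kolFreq, ha]

/-- **The laminar Kolmogorov family is shear invariant**: `K_b(x + a) = K_b(x)` whenever `a 1 = 0`
(the field depends on `x₁` only). [folklore] -/
theorem kolField_add_of_apply_one (b : ℝ) {a : UnitAddTorus (Fin 3)} (ha : a 1 = 0)
    (x : UnitAddTorus (Fin 3)) : kolField b (x + a) = kolField b x :=
  realTrigPoly_add_of_mFourier_eq_one _ (fun _ hk => mFourier_eq_one_of_mem_kolSet hk ha) x

/-- Translated Kolmogorov tests are the same tests: `(fun x => K_b (x + a)) = K_b` for `a 1 = 0`. [folklore] -/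
theorem kolField_comp_add_of_apply_one (b : ℝ) {a : UnitAddTorus (Fin 3)} (ha : a 1 = 0) :
    (fun x => kolField b (x + a)) = kolField b :=
  funext fun x => kolField_add_of_apply_one b ha x

/-- **Pairings of a laminar state with translated tests**: `([K_b], g(· + a)) = ([K_b], g)` for every
shear translation `a 1 = 0` and every test field `g` (translation invariance of Haar measure on `𝕋³`
and shear invariance of `K_b`; no hypothesis on `g`). [folklore] -/
theorem pairing_kolState_comp_add (b : ℝ) {a : UnitAddTorus (Fin 3)} (ha : a 1 = 0)
    (g : UnitAddTorus (Fin 3) → EuclideanSpace ℝ (Fin 3)) :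
    Torus.pairing ((kolState b).1 : L2T3) (fun x => g (x + a)) = Torus.pairing ((kolState b).1 : L2T3) g := by
  unfold Torus.pairing
  rw [integral_congr_ae ((coe_kolState_ae b).mono fun x hx =>
      show ⟪(((kolState b).1 : L2T3) : UnitAddTorus (Fin 3) → EuclideanSpace ℝ (Fin 3)) x, g (x + a)⟫_ℝ =
        ⟪kolField b x, g (x + a)⟫_ℝ by rw [hx]),
    integral_congr_ae ((coe_kolState_ae b).mono fun x hx =>
      show ⟪(((kolState b).1 : L2T3) : UnitAddTorus (Fin 3) → EuclideanSpace ℝ (Fin 3)) x, g x⟫_ℝ =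
        ⟪kolField b x, g x⟫_ℝ by rw [hx])]
  have h : (fun x => ⟪kolField b x, g (x + a)⟫_ℝ) = fun x => (fun y => ⟪kolField b y, g y⟫_ℝ) (x + a) := by
    funext x
    simp only [kolField_add_of_apply_one b ha x]
  rw [h]
  exact integral_add_right_eq_self (fun y => ⟪kolField b y, g y⟫_ℝ) a

/-- The cylindrical coordinate map `u ↦ ((u, gᵢ))ᵢ` is measurable for `L²` tests. [folklore] -/
theorem measurable_pairings {m : ℕ} {g : Fin m → UnitAddTorus (Fin 3) → EuclideanSpace ℝ (Fin 3)}
    (hg : ∀ i, MemLp (g i) 2 volume) :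
    Measurable fun u : Torus.energySpace (Fin 3) => fun i => Torus.pairing (u.1 : L2T3) (g i) :=
  (continuous_pi fun i => Torus.continuous_pairing_coe (hg i)).measurable

/-- **The Dirac mass at a laminar state has shear-invariant cylindrical statistics** (the line's
`LawSym N L (δ_{[K_b]})`, for every `L`, indeed for every shear translation): for `a 1 = 0` and smooth
tests `gᵢ`, the law of `((u, gᵢ(· + a)))ᵢ` under `δ_{[K_b]}` equals the law of `((u, gᵢ))ᵢ`. [folklore] -/
theorem lawSym_dirac_kolState (b : ℝ) {a : UnitAddTorus (Fin 3)} (ha : a 1 = 0) {m : ℕ}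
    {g : Fin m → UnitAddTorus (Fin 3) → EuclideanSpace ℝ (Fin 3)} (hg : ∀ i, Torus.IsSmooth (g i)) :
    Measure.map (fun u : Torus.energySpace (Fin 3) => fun i => Torus.pairing (u.1 : L2T3) (fun x => g i (x + a)))
        (Measure.dirac (kolState b)) =
      Measure.map (fun u : Torus.energySpace (Fin 3) => fun i => Torus.pairing (u.1 : L2T3) (g i))
        (Measure.dirac (kolState b)) := by
  have hga : ∀ i, Torus.IsSmooth (fun x => g i (x + a)) := fun i => (hg i).comp_add_right a
  rw [Measure.map_dirac' (measurable_pairings fun i => (hga i).memLp 2),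
    Measure.map_dirac' (measurable_pairings fun i => (hg i).memLp 2)]
  congr 1
  funext i
  exact pairing_kolState_comp_add b ha (g i)


/-! ## S2q at level one: the body of `stub_axialQuadRigidity` fails for every `L` -/

/-- The BODY of `stub_axialQuadRigidity` (line `axis-sectors`, S2q) at level `N` and symmetry order
`L` (verbatim; the stub is `∀ N, 2 ≤ N → ∀ L, 2 * N < L → AxialQuadRigidityAt N L`): every
`H_L`-invariant homogeneous quadratic Casimir of level-`N` Galerkin–Euler has gradient
`2α P_N u + 2β curl P_N u`. -/
def AxialQuadRigidityAt (N L : ℕ) : Prop :=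
  ∀ (m : ℕ) (g : Fin m → UnitAddTorus (Fin 3) → EuclideanSpace ℝ (Fin 3))
    (P : MvPolynomial (Fin m) ℝ), (∀ i, IsBandTest N (g i)) → P.IsHomogeneous 2 →
    (∀ a : UnitAddTorus (Fin 3), a 1 = 0 → L • a = 0 → ∀ u : Torus.energySpace (Fin 3), IsLevel N u →
      MvPolynomial.eval (fun j => Torus.pairing u.1 (fun x => g j (x + a))) P =
        MvPolynomial.eval (fun j => Torus.pairing u.1 (g j)) P) →
    (∀ u : Torus.energySpace (Fin 3), IsLevel N u →
      Torus.nsGeneratorPairing (d := Fin 3) 0 0 u (polyGrad g P u) = 0) →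
    ∃ α β : ℝ, ∀ u : Torus.energySpace (Fin 3), IsLevel N u →
      ∀ x, polyGrad g P u x =
        (2 * α) • Torus.fourierTruncate N (u.1 : UnitAddTorus (Fin 3) → EuclideanSpace ℝ (Fin 3)) x +
        (2 * β) • BDSV.curl (Torus.fourierTruncate N
          (u.1 : UnitAddTorus (Fin 3) → EuclideanSpace ℝ (Fin 3))) x

/-- Axial rigidity is WEAKER than plain rigidity: `QuadRigidity N → AxialQuadRigidityAt N L`
(the symmetry hypothesis is simply not used). [folklore] -/
theorem axialQuadRigidityAt_of_quadRigidity {N : ℕ} (h : QuadRigidity N) (L : ℕ) :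
    AxialQuadRigidityAt N L :=
  fun m g P hg hP _ hC => h m g P hg hP hC

/-- **`¬ AxialQuadRigidityAt 1 L` for every `L`.** The quadratic observable `(u, K_1)²` is a Casimir
of level-`1` Galerkin–Euler (`B_1 ≡ 0`), it is invariant under EVERY shear translation (`K_1` is), and
its gradient `2(u, K_1)K_1` is not of the form `2αP_1u + 2β curl P_1u` (`not_quadRigidity_one`'s two
test states `[K_1]`, `[K'_1]`). So the guard `2 ≤ N` of S2q is load-bearing even in the
shear-symmetric category. [folklore] -/
theorem not_axialQuadRigidityAt_one (L : ℕ) : ¬ AxialQuadRigidityAt 1 L := by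
  intro h
  have hsym : ∀ a : UnitAddTorus (Fin 3), a 1 = 0 → L • a = 0 →
      ∀ u : Torus.energySpace (Fin 3), IsLevel 1 u →
      MvPolynomial.eval (fun _ : Fin 1 => Torus.pairing (u.1 : L2T3) (fun x => kolField 1 (x + a)))
          (MvPolynomial.X 0 ^ 2 : MvPolynomial (Fin 1) ℝ) =
        MvPolynomial.eval (fun _ : Fin 1 => Torus.pairing (u.1 : L2T3) (kolField 1))
          (MvPolynomial.X 0 ^ 2) := by
    intro a ha _ u _
    rw [kolField_comp_add_of_apply_one 1 ha]
  obtain ⟨α, β, hαβ⟩ := h 1 (fun _ => kolField 1) (MvPolynomial.X 0 ^ 2)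
    (fun _ => isBandTest_kolField 1) ((MvPolynomial.isHomogeneous_X ℝ (0 : Fin 1)).pow 2) hsym
    (fun u hu => euler_bracket_polyGrad_eq_zero_of_level_one _ _ (fun _ => isBandTest_kolField 1) u hu)
  have h0 := hαβ (kolState 1) (isLevel_kolState 1 le_rfl)
  have h1 := hαβ (kolState₂ 1) (isLevel_kolState₂ 1 le_rfl)
  simp only [polyGrad_X_sq, pairing_kolState_kolField, pairing_kolState₂_kolField,
    fourierTruncate_coe_eq (isSmooth_kolField 1) (coe_kolState_ae 1) (isLevel_kolState 1 le_rfl),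
    fourierTruncate_coe_eq (isSmooth_kolField₂ 1) (coe_kolState₂_ae 1) (isLevel_kolState₂ 1 le_rfl)]
    at h0 h1
  -- Step 1: `α = 1/2` from `u = [K_1]`
  obtain ⟨x₀, hx₀⟩ := exists_ne_zero_of_integral_norm_sq_ne_zero (F := kolField 1)
    (by rw [integral_norm_sq_kolField]; norm_num)
  have hα : α = 1 / 2 := by
    have e := congrArg (fun v => ⟪kolField 1 x₀, v⟫_ℝ) (h0 x₀)
    simp only [inner_add_right, inner_smul_right, real_inner_self_eq_norm_sq] at e
    rw [kolField, inner_curl_realTrigPoly_kolCoeff, ← kolField] at e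
    have hn : ‖kolField 1 x₀‖ ^ 2 ≠ 0 := by positivity
    have e' : (1 - 2 * α) * ‖kolField 1 x₀‖ ^ 2 = 0 := by nlinarith [e]
    rcases mul_eq_zero.1 e' with h' | h'
    · linarith
    · exact absurd h' hn
  -- Step 2: at `u = [K'_1]` the identity forces `K'_1 ≡ 0`
  obtain ⟨x₁, hx₁⟩ := exists_ne_zero_of_integral_norm_sq_ne_zero (F := kolField₂ 1)
    (by rw [integral_norm_sq_kolField₂]; norm_num)
  have e := congrArg (fun v => ⟪kolField₂ 1 x₁, v⟫_ℝ) (h1 x₁)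
  simp only [inner_add_right, inner_smul_right, real_inner_self_eq_norm_sq] at e
  rw [kolField₂, inner_curl_realTrigPoly_kolCoeff, ← kolField₂, hα] at e
  have hn : ‖kolField₂ 1 x₁‖ ^ 2 ≠ 0 := by positivity
  apply hn
  nlinarith [e]

/-- The natural strengthening "`∀ N ≥ 1`" of `stub_axialQuadRigidity` is FALSE (at `N = 1`, any
admissible `L`, e.g. `L = 3 > 2·1`). [folklore] -/
theorem not_forall_axialQuadRigidityAt_of_one_le :
    ¬ ∀ N : ℕ, 1 ≤ N → ∀ L : ℕ, 2 * N < L → AxialQuadRigidityAt N L :=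
  fun h => not_axialQuadRigidityAt_one 3 (h 1 le_rfl 3 (by norm_num))


/-! ## S2c at level one: the body of `stub_noAxialCubicCasimir` fails for every `L` -/

/-- The BODY of `stub_noAxialCubicCasimir` (line `axis-sectors`, S2c) at level `N` and symmetry
order `L` (verbatim; the stub is `∃ᶠ N in atTop, ∀ L, 3 * N < L → NoAxialCubicCasimirAt N L`): level-`N`
Galerkin–Euler has no nonzero `H_L`-invariant homogeneous cubic Casimir. -/
def NoAxialCubicCasimirAt (N L : ℕ) : Prop :=
  ∀ (m : ℕ) (g : Fin m → UnitAddTorus (Fin 3) → EuclideanSpace ℝ (Fin 3))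
    (P : MvPolynomial (Fin m) ℝ), (∀ i, IsBandTest N (g i)) → P.IsHomogeneous 3 →
    (∀ a : UnitAddTorus (Fin 3), a 1 = 0 → L • a = 0 → ∀ u : Torus.energySpace (Fin 3), IsLevel N u →
      MvPolynomial.eval (fun j => Torus.pairing u.1 (fun x => g j (x + a))) P =
        MvPolynomial.eval (fun j => Torus.pairing u.1 (g j)) P) →
    (∀ u : Torus.energySpace (Fin 3), IsLevel N u →
      Torus.nsGeneratorPairing (d := Fin 3) 0 0 u (polyGrad g P u) = 0) →
    ∀ u : Torus.energySpace (Fin 3), IsLevel N u →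
      MvPolynomial.eval (fun j => Torus.pairing u.1 (g j)) P = 0

/-- `NoCubicCasimir N → NoAxialCubicCasimirAt N L` (the symmetry hypothesis is not used). [folklore] -/
theorem noAxialCubicCasimirAt_of_noCubicCasimir {N : ℕ} (h : NoCubicCasimir N) (L : ℕ) :
    NoAxialCubicCasimirAt N L :=
  fun m g P hg hP _ hC => h m g P hg hP hC

/-- **`¬ NoAxialCubicCasimirAt 1 L` for every `L`.** The cubic observable `(u, K_1)³` is a Casimir of
level-`1` Galerkin–Euler, invariant under every shear translation, and equals `(1/2)³ ≠ 0` at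
`u = [K_1]`. So the `∃ᶠ N` of S2c cannot be strengthened to "every `N ≥ 1`". [folklore] -/
theorem not_noAxialCubicCasimirAt_one (L : ℕ) : ¬ NoAxialCubicCasimirAt 1 L := by
  intro h
  have hsym : ∀ a : UnitAddTorus (Fin 3), a 1 = 0 → L • a = 0 →
      ∀ u : Torus.energySpace (Fin 3), IsLevel 1 u →
      MvPolynomial.eval (fun _ : Fin 1 => Torus.pairing (u.1 : L2T3) (fun x => kolField 1 (x + a)))
          (MvPolynomial.X 0 ^ 3 : MvPolynomial (Fin 1) ℝ) =
        MvPolynomial.eval (fun _ : Fin 1 => Torus.pairing (u.1 : L2T3) (kolField 1))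
          (MvPolynomial.X 0 ^ 3) := by
    intro a ha _ u _
    rw [kolField_comp_add_of_apply_one 1 ha]
  have h1 := h 1 (fun _ => kolField 1) (MvPolynomial.X 0 ^ 3) (fun _ => isBandTest_kolField 1)
    ((MvPolynomial.isHomogeneous_X ℝ (0 : Fin 1)).pow 3) hsym
    (fun u hu => euler_bracket_polyGrad_eq_zero_of_level_one _ _ (fun _ => isBandTest_kolField 1) u hu)
    (kolState 1) (isLevel_kolState 1 le_rfl)
  rw [map_pow, MvPolynomial.eval_X, pairing_kolState_kolField] at h1
  norm_num at h1

/-- The natural strengthening "`∀ N ≥ 1`" of `stub_noAxialCubicCasimir` is FALSE (at `N = 1`,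
`L = 4 > 3·1`). [folklore] -/
theorem not_forall_noAxialCubicCasimirAt_of_one_le :
    ¬ ∀ N : ℕ, 1 ≤ N → ∀ L : ℕ, 3 * N < L → NoAxialCubicCasimirAt N L :=
  fun h => not_noAxialCubicCasimirAt_one 4 (h 1 le_rfl 4 (by norm_num))


/-! ## S3′ needs its no-Casimir antecedent: the symmetric defect certificate is not unconditional -/

/-- MUTATED S3′: `stub_axialDefectCertificate` of line `axis-sectors` with its antecedent "no
`H_L`-invariant cubic Casimir at level `N`" DELETED (everything else verbatim: `3N < L`, smooth
shear-invariant force, level-`N` probability law with finite fourth moments and `H_L`-invariant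
cylindrical statistics ⟹ a defect certificate). FALSE: `not_axialDefectCertificateUnconditional`. -/
def AxialDefectCertificateUnconditional : Prop :=
  ∀ (N L : ℕ), 3 * N < L →
    ∀ (ν : ℝ) (f : UnitAddTorus (Fin 3) → EuclideanSpace ℝ (Fin 3)), Torus.IsSmooth f →
    (∀ a : UnitAddTorus (Fin 3), a 1 = 0 → ∀ x, f (x + a) = f x) →
    ∀ μ : Measure (Torus.energySpace (Fin 3)), IsProbabilityMeasure μ → (∀ᵐ u ∂μ, IsLevel N u) →
    Integrable (fun u : Torus.energySpace (Fin 3) => ‖u‖ ^ 4) μ →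
    (∀ a : UnitAddTorus (Fin 3), a 1 = 0 → L • a = 0 →
      ∀ (m : ℕ) (g : Fin m → UnitAddTorus (Fin 3) → EuclideanSpace ℝ (Fin 3)),
      (∀ i, IsBandTest N (g i)) →
      Measure.map (fun u : Torus.energySpace (Fin 3) => fun i => Torus.pairing u.1 (fun x => g i (x + a))) μ =
        Measure.map (fun u : Torus.energySpace (Fin 3) => fun i => Torus.pairing u.1 (g i)) μ) →
    HasDefectCertificate ν f N μ

/-- **The no-Casimir antecedent of S3′ is load-bearing**: the symmetric but unconditional
defect-certificate statement is false. Witness `N = 1`, `L = 4`, `ν = 1`, `f = 0` (shear invariant),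
`μ = δ_{[K_1]}` (level one, finite moments, `H_L`-symmetric statistics by `lawSym_dirac_kolState`):
no certificate exists (`not_hasDefectCertificate_dirac_kolState`: every Euler derivative vanishes at
level one and the cubic row of `(u, K_1)³` is `−3π²/2`). [folklore] -/
theorem not_axialDefectCertificateUnconditional : ¬ AxialDefectCertificateUnconditional := by
  haveI : MeasurableSingletonClass (Torus.energySpace (Fin 3)) :=
    OpensMeasurableSpace.toMeasurableSingletonClass
  intro h
  refine not_hasDefectCertificate_dirac_kolState (h 1 4 (by norm_num) 1 0 ?_ (fun _ _ _ => rfl)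
    (Measure.dirac (kolState 1)) inferInstance ?_ (Torus.integrable_dirac _ _) ?_)
  · exact Torus.isSmooth_const (0 : EuclideanSpace ℝ (Fin 3))
  · rw [ae_dirac_eq]; simpa using isLevel_kolState 1 le_rfl
  · intro a ha _ m g hg
    exact lawSym_dirac_kolState 1 ha fun i => (hg i).1

end

end Summit.AnomalousDissipation.AnomalousDissipation.Theorems.QuarticGate.Negative
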